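import Mathlib
import Literature.Computability.AlgebraicComplexity.FlatteningBound
import Literature.Computability.AlgebraicComplexity.MatMulTotalComplexity
import Literature.Computability.AlgebraicComplexity.MatMulTotalComplexityProofs
import Literature.Computability.AlgebraicComplexity.StrassenLaserOmegaBound
import Summits.MatrixMultiplication.MatrixMultiplication.Theorems.GraphEquationsSystems

/-!
# The generator system `{c_il − Σ_j a_ij b_jl}` (`GraphEquations`, 2/4)

Support module for the decomp-mm node `N5²³` «GraphEquations».  From a fan-in-two circuit over
`ℂ[A,B]` computing all entries of `AB` (BCS Prop. (15.1), PROVED in the tree: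
`BurgisserClausenShokrollahi1997_prop151_holds`) we build the GENERATOR SYSTEM: rename into
`ℂ[A,B,C]` and append the `n²` test gates `c_il − (AB)_il`.  It is correct (zero set `= W_n`,
`generatorSystem_zeroSet`), reduced EVERYWHERE (its `C`-Jacobian is a reindexed identity,
`generatorSystem_reducedAt`) and costs `size + n²`.  Consequence (UNCONDITIONAL):
`eqAdmissibleRed_of_omega_lt : ω < β → EqAdmissibleRed β` — which makes the pieces `V` and `H_mult`
of the node NECESSARY (`GraphEquationsKernel`) — and the non-vacuity witness
`eqAdmissibleRed_five_halves` from the tree's kernel theorem `ω < 2.48` (`BCS1997_cor_15_33`).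

Sources: [BurgisserClausenShokrollahi1997, Prop. (15.1) p.375–377, Problem 16.3 p.483,
Cor. (15.33)].
-/

set_option linter.dupNamespace false

noncomputable section

open scoped BigOperators

namespace Summit.MatrixMultiplication.MatrixMultiplication.Theorems.GraphEquations

open Literature.Computability.AlgebraicComplexity
open Literature.Computability.AlgebraicComplexity.ArithCircuit

section Construction

variable {n : ℕ}

/-- Fan-in is invariant under renaming of variables (local copy of a private tree lemma). -/
theorem fanIn_rename {σ τ : Type} (e : σ → τ) (g : Gate ℂ σ) : (g.rename e).fanIn = g.fanIn := by
  cases g <;> simp [Gate.rename, Gate.fanIn, Gate.args]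

/-- Renamed operands read renamed values (local copy of a private tree lemma). -/
theorem operand_eval_rename {σ τ : Type} (e : σ → τ) (vals : List (MvPolynomial σ ℂ))
    (u : Operand ℂ σ) :
    (u.rename e).eval (vals.map (MvPolynomial.rename e)) = MvPolynomial.rename e (u.eval vals) := by
  cases u with
  | var i => simp [Operand.rename, Operand.eval]
  | const c => simp [Operand.rename, Operand.eval]
  | gate j =>
    simp only [Operand.rename, Operand.eval, List.getD_eq_getElem?_getD, List.getElem?_map]
    cases vals[j]? <;> simp

/-- Renamed gates compute renamed values (local copy of a private tree lemma). -/
theorem gate_eval_rename {σ τ : Type} (e : σ → τ) (vals : List (MvPolynomial σ ℂ)) (g : Gate ℂ σ) :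
    (g.rename e).eval (vals.map (MvPolynomial.rename e)) = MvPolynomial.rename e (g.eval vals) := by
  cases g with
  | sum args =>
    simp only [Gate.rename, Gate.eval, List.map_map, map_list_sum]
    congr 1
    simp [Function.comp_def, operand_eval_rename]
  | prod args =>
    simp only [Gate.rename, Gate.eval, List.map_map, map_list_prod]
    congr 1
    simp [Function.comp_def, operand_eval_rename]

/-- Gate values of a renamed gate list (local copy of a private tree lemma). -/
theorem gateValues_rename' {σ τ : Type} (e : σ → τ) (gs : List (Gate ℂ σ)) :
    gateValues (gs.map (Gate.rename e)) = (gateValues gs).map (MvPolynomial.rename e) := by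
  induction gs using List.reverseRecOn with
  | nil => rfl
  | append_singleton gs g ih =>
    rw [List.map_append, List.map_singleton, gateValues_append_singleton,
      gateValues_append_singleton, ih, gate_eval_rename, List.map_append, List.map_singleton]

/-- The test gate `c_p − (value of gate j)` (fan-in two). -/
def testGate (p : Fin n × Fin n) (j : ℕ) : Gate ℂ (GraphVars n) :=
  .sum [(1, .var (Sum.inr p)), (-1, .gate j)]

/-- Test gates have fan-in two. -/
theorem testGate_fanIn (p : Fin n × Fin n) (j : ℕ) : (testGate p j).fanIn = 2 := by
  simp [testGate, Gate.fanIn, Gate.args]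

/-- A test gate referring to an index inside `vals` ignores appended values. -/
theorem testGate_eval_append (p : Fin n × Fin n) {j : ℕ}
    (vals ws : List (MvPolynomial (GraphVars n) ℂ)) (hj : j < vals.length) :
    (testGate p j).eval (vals ++ ws) = (testGate p j).eval vals := by
  simp [testGate, Gate.eval, Operand.eval, List.getD_eq_getElem?_getD, List.getElem?_append_left hj]

/-- The value of a test gate. -/
theorem testGate_eval (p : Fin n × Fin n) (j : ℕ) (vals : List (MvPolynomial (GraphVars n) ℂ)) :
    (testGate p j).eval vals = MvPolynomial.X (Sum.inr p) - vals.getD j 0 := by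
  simp [testGate, Gate.eval, Operand.eval, sub_eq_add_neg]

/-- Appending test gates that refer only to the base list: the base values are untouched and each
test gate is evaluated against them. -/
theorem gateValues_append_tests (G : List (Gate ℂ (GraphVars n))) (idx : Fin n × Fin n → ℕ)
    (hidx : ∀ p, idx p < G.length) (ps : List (Fin n × Fin n)) :
    gateValues (G ++ ps.map fun p => testGate p (idx p)) =
      gateValues G ++ ps.map fun p => (testGate p (idx p)).eval (gateValues G) := by
  induction ps using List.reverseRecOn with
  | nil => simp
  | append_singleton ps p ih =>
    rw [List.map_append, List.map_singleton, ← List.append_assoc, gateValues_append_singleton, ih,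
      List.map_append, List.map_singleton, List.append_assoc]
    congr 2
    rw [testGate_eval_append]
    simpa using hidx p

/-- Evaluating the generic product entry after embedding `ℂ[A,B] ↪ ℂ[A,B,C]`. -/
theorem eval_rename_entry (x : GraphVars n → ℂ) (i l : Fin n) :
    MvPolynomial.eval x (MvPolynomial.rename Sum.inl (genericMatMulEntry ℂ n i l)) =
      ∑ j : Fin n, x (Sum.inl (Sum.inl (i, j))) * x (Sum.inl (Sum.inr (j, l))) := by
  simp [genericMatMulEntry, map_sum]

/-- The `C`-partial derivatives of an embedded `ℂ[A,B]`-polynomial vanish. -/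
theorem pderiv_inr_rename_inl (q : Fin n × Fin n) (f : MvPolynomial (MatMulVars n) ℂ) :
    MvPolynomial.pderiv (Sum.inr q)
      (MvPolynomial.rename (Sum.inl : MatMulVars n → GraphVars n) f) = 0 := by
  classical
  apply MvPolynomial.pderiv_eq_zero_of_notMem_vars
  intro hmem
  have := MvPolynomial.vars_rename (Sum.inl : MatMulVars n → GraphVars n) f hmem
  simp at this

/-- **The generator system.** From a fan-in-two circuit `P` over `ℂ[A,B]` computing all entries of
`AB` (entry `p` at gate `idx p`): rename into `ℂ[A,B,C]` and append the `n²` test gates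
`c_p − (AB)_p`, enumerated along `finProdFinEquiv : Fin (n·n) ≃ Fin n × Fin n`. -/
def generatorSystem (P : ArithCircuit ℂ (MatMulVars n)) (idx : Fin n × Fin n → ℕ) : EqSystem n where
  circuit :=
    { gates := P.gates.map (Gate.rename Sum.inl) ++
        (List.ofFn fun s : Fin (n * n) => finProdFinEquiv.symm s).map fun p => testGate p (idx p)
      output := .const 0 }
  tests := List.ofFn fun s : Fin (n * n) => P.size + (s : ℕ)

variable (P : ArithCircuit ℂ (MatMulVars n)) (idx : Fin n × Fin n → ℕ)

/-- Cost of the generator system: `size P + n²`. -/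
theorem generatorSystem_cost : (generatorSystem P idx).cost = P.size + n * n := by
  simp [generatorSystem, EqSystem.cost, ArithCircuit.size]

/-- The generator system is fan-in two if `P` is. -/
theorem generatorSystem_isFanInTwo (hP : P.IsFanInTwo) :
    (generatorSystem P idx).circuit.IsFanInTwo := by
  intro g hg
  simp only [generatorSystem, List.mem_append, List.mem_map, List.mem_ofFn] at hg
  rcases hg with ⟨g', hg', rfl⟩ | ⟨p, _, rfl⟩
  · rw [fanIn_rename]; exact hP g' hg'
  · rw [testGate_fanIn]

/-- The generator system has `n²` tests. -/
theorem generatorSystem_tests_length : (generatorSystem P idx).tests.length = n * n := by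
  simp [generatorSystem]

/-- The test polynomials of the generator system are `c_p − (AB)_p`. -/
theorem generatorSystem_testPoly (hidx : ∀ p, idx p < P.size)
    (hval : ∀ p : Fin n × Fin n,
      (gateValues P.gates)[idx p]? = some (genericMatMulEntry ℂ n p.1 p.2))
    (s : Fin (n * n)) :
    (generatorSystem P idx).testPoly (P.size + (s : ℕ)) =
      MvPolynomial.X (Sum.inr (finProdFinEquiv.symm s)) -
        MvPolynomial.rename Sum.inl
          (genericMatMulEntry ℂ n (finProdFinEquiv.symm s).1 (finProdFinEquiv.symm s).2) := by
  have hlenG : (P.gates.map (Gate.rename (Sum.inl : MatMulVars n → GraphVars n))).length =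
      P.size := by
    simp [ArithCircuit.size]
  have hidx' : ∀ p, idx p <
      (P.gates.map (Gate.rename (Sum.inl : MatMulVars n → GraphVars n))).length :=
    fun p => by rw [hlenG]; exact hidx p
  have hg : (generatorSystem P idx).circuit.gates =
      P.gates.map (Gate.rename Sum.inl) ++
        (List.ofFn fun s : Fin (n * n) => finProdFinEquiv.symm s).map
          fun p => testGate p (idx p) := rfl
  have hvals : gateValues (generatorSystem P idx).circuit.gates =
      (gateValues P.gates).map (MvPolynomial.rename Sum.inl) ++
        List.ofFn fun s : Fin (n * n) =>
          (testGate (finProdFinEquiv.symm s) (idx (finProdFinEquiv.symm s))).eval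
            ((gateValues P.gates).map (MvPolynomial.rename Sum.inl)) := by
    rw [hg, gateValues_append_tests _ idx hidx', gateValues_rename', List.map_ofFn]
    rfl
  have hlenV : ((gateValues P.gates).map
      (MvPolynomial.rename (Sum.inl : MatMulVars n → GraphVars n))).length = P.size := by
    simp [ArithCircuit.size]
  unfold EqSystem.testPoly
  rw [hvals, List.getD_eq_getElem?_getD, List.getElem?_append_right (by rw [hlenV]; omega), hlenV,
    Nat.add_sub_cancel_left, List.getElem?_ofFn]
  simp only [s.2, dite_true, Option.getD_some]
  rw [testGate_eval, List.getD_eq_getElem?_getD, List.getElem?_map, hval]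
  simp

/-- The generator system cuts out exactly the graph. -/
theorem generatorSystem_zeroSet (hidx : ∀ p, idx p < P.size)
    (hval : ∀ p : Fin n × Fin n,
      (gateValues P.gates)[idx p]? = some (genericMatMulEntry ℂ n p.1 p.2)) :
    (generatorSystem P idx).zeroSet = mmGraph n := by
  ext x
  simp only [EqSystem.zeroSet, Set.mem_setOf_eq, mmGraph]
  constructor
  · intro h i l
    have hmem : P.size + ((finProdFinEquiv (i, l) : Fin (n * n)) : ℕ) ∈
        (generatorSystem P idx).tests :=
      List.mem_ofFn.2 ⟨finProdFinEquiv (i, l), rfl⟩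
    have := h _ hmem
    rw [generatorSystem_testPoly P idx hidx hval] at this
    simpa [sub_eq_zero, eval_rename_entry] using this
  · intro h j hj
    simp only [generatorSystem, List.mem_ofFn] at hj
    obtain ⟨s, rfl⟩ := hj
    rw [generatorSystem_testPoly P idx hidx hval]
    simp [eval_rename_entry, h]

/-- The `C`-Jacobian of the generator system is a reindexed identity matrix (at every point). -/
theorem generatorSystem_jacobian (hidx : ∀ p, idx p < P.size)
    (hval : ∀ p : Fin n × Fin n,
      (gateValues P.gates)[idx p]? = some (genericMatMulEntry ℂ n p.1 p.2))
    (x : GraphVars n → ℂ) :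
    (generatorSystem P idx).jacobianC x =
      (1 : Matrix (Fin n × Fin n) (Fin n × Fin n) ℂ).submatrix
        (fun s => finProdFinEquiv.symm (Fin.cast (generatorSystem_tests_length P idx) s)) id := by
  ext s q
  have hs : (generatorSystem P idx).tests.get s =
      P.size + ((Fin.cast (generatorSystem_tests_length P idx) s : Fin (n * n)) : ℕ) := by
    simp [generatorSystem]
  simp only [EqSystem.jacobianC, Matrix.of_apply, Matrix.submatrix_apply]
  rw [hs, generatorSystem_testPoly P idx hidx hval, map_sub, pderiv_inr_rename_inl, sub_zero,
    MvPolynomial.pderiv_X]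
  classical
  simp [Pi.single_apply, Matrix.one_apply, eq_comm]

/-- The generator system is reduced at every point. -/
theorem generatorSystem_reducedAt (hidx : ∀ p, idx p < P.size)
    (hval : ∀ p : Fin n × Fin n,
      (gateValues P.gates)[idx p]? = some (genericMatMulEntry ℂ n p.1 p.2))
    (x : GraphVars n → ℂ) : (generatorSystem P idx).ReducedAt x := by
  unfold EqSystem.ReducedAt
  let e : Fin (generatorSystem P idx).tests.length ≃ Fin n × Fin n :=
    (finCongr (generatorSystem_tests_length P idx)).trans finProdFinEquiv.symm
  have hJ : (generatorSystem P idx).jacobianC x =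
      (1 : Matrix (Fin n × Fin n) (Fin n × Fin n) ℂ).submatrix e (Equiv.refl _) := by
    rw [generatorSystem_jacobian P idx hidx hval]; rfl
  rw [hJ, Matrix.rank_submatrix, Matrix.rank_one, Fintype.card_prod, Fintype.card_fin]

end Construction

/-! ## Consequences: admissibility above `ω` (unconditional) -/

/-- **Generators are admissible above `ω`** (via BCS Prop. (15.1), proved in the tree as
`BurgisserClausenShokrollahi1997_prop151_holds`): for every `β > ω(ℂ)` there are correct equation
systems of cost `O(n^β)` that are reduced AT THE ORIGIN (indeed everywhere) — compute `AB` by a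
fast circuit and subtract. -/
theorem exists_correct_reducedAt_zero_of_omega_lt {β : ℝ} (hβ : omega ℂ < β) :
    ∃ c : ℝ, ∀ n : ℕ, 1 ≤ n → ∃ E : EqSystem n, E.Correct ∧ E.ReducedAt 0 ∧
      (E.cost : ℝ) ≤ c * (n : ℝ) ^ β := by
  obtain ⟨C, hC⟩ := BurgisserClausenShokrollahi1997_prop151_holds ℂ (β - omega ℂ) (sub_pos.2 hβ)
  refine ⟨C + 1, fun n hn => ?_⟩
  obtain ⟨P, hP2, hPc, hPs⟩ := hC n hn
  -- gate indices of the entries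
  have hex : ∀ p : Fin n × Fin n, ∃ j,
      (gateValues P.gates)[j]? = some (genericMatMulEntry ℂ n p.1 p.2) :=
    fun p => List.mem_iff_getElem?.1 (hPc p.1 p.2)
  choose idx hidx using hex
  have hlt : ∀ p, idx p < P.size := fun p => by
    have := (List.getElem?_eq_some_iff.1 (hidx p)).1
    simpa [ArithCircuit.size] using this
  refine ⟨generatorSystem P idx, ⟨generatorSystem_isFanInTwo P idx hP2,
    generatorSystem_zeroSet P idx hlt hidx⟩, generatorSystem_reducedAt P idx hlt hidx 0, ?_⟩
  rw [generatorSystem_cost]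
  have hn1 : (1 : ℝ) ≤ n := by exact_mod_cast hn
  have hω2 : (2 : ℝ) ≤ β := (omega_two_le ℂ).trans hβ.le
  have hsq : (n : ℝ) * n ≤ (n : ℝ) ^ β := by
    have h := Real.rpow_le_rpow_of_exponent_le hn1 (show ((2 : ℕ) : ℝ) ≤ β by exact_mod_cast hω2)
    rw [Real.rpow_natCast, sq] at h
    exact h
  have hβeq : omega ℂ + (β - omega ℂ) = β := by ring
  rw [hβeq] at hPs
  push_cast
  linarith

/-- For every `β > ω(ℂ)`, `EqAdmissibleRed β` (unconditional). -/
theorem eqAdmissibleRed_of_omega_lt {β : ℝ} (hβ : omega ℂ < β) : EqAdmissibleRed β := by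
  obtain ⟨c, hc⟩ := exists_correct_reducedAt_zero_of_omega_lt hβ
  refine ⟨c, fun n hn => ?_⟩
  obtain ⟨E, hE, h0, hcost⟩ := hc n hn
  exact ⟨E, hE, EqSystem.genericallyReduced_of_reducedAt_zero h0, hcost⟩

/-- For every `β > ω(ℂ)`, `EqAdmissible β` (unconditional). -/
theorem eqAdmissible_of_omega_lt {β : ℝ} (hβ : omega ℂ < β) : EqAdmissible β :=
  (eqAdmissibleRed_of_omega_lt hβ).eqAdmissible

/-- **Non-vacuity**, unconditional: generically reduced correct systems of cost `O(n^{5/2})`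
exist, from the tree's kernel theorem `ω < 2.48` (BCS Cor. (15.33)). -/
theorem eqAdmissibleRed_five_halves : EqAdmissibleRed (5 / 2) :=
  eqAdmissibleRed_of_omega_lt (lt_trans (BCS1997_cor_15_33 ℂ) (by norm_num))

end Summit.MatrixMultiplication.MatrixMultiplication.Theorems.GraphEquations

end
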